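/-
Copyright (c) 2026 the pub-hodgecm-mathlib formalisation cell (harness21).  Prover seat hodgecm-mathlib-K2Liu-p14 (g0): Track B «K2-LIT»,
hLiu418 = stmt-HodgeConjecture-24832; LEAD F0P6-plan (g13) RULING M-157b + «=» 2026-09-04T08:59:05Z «(β4-ii) → (β4-i) → (β4-iii)», file (β4-i) part B.
-/
import Summits.HodgeConjecture.HodgeConjecture.Theorems.K2LiuGL2PrimitiveRowNeighbourhoods   -- ★ part A (row algebra), brings ★ (β1)
import Literature.NumberTheory.Automorphic.GLnFiniteAdeleRestrictedProduct                   -- ★ `GLn.evalAt`, `mem_glFiniteIntegralLevel_iff_forall_evalAt`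
import Literature.NumberTheory.Automorphic.GLnAdelicStructureProofs                           -- ★ `isCompact_integralFiniteAdeles`
import Literature.NumberTheory.Automorphic.IdeleUnitBoxSplittingConstants                     -- ★ `valued_eq_one_iff_valuation_eq_one`
import Literature.NumberTheory.Automorphic.JacquetModuleProofs                                -- ★ `DeltaCharBorel.isOpen_setOf_valuation_le`
import HarnessLib

/-!
# Crux `HLiu418`, road `K2_Liu`, Road Φ organ G5 (β) «Godement sections exhaust», file (β4-i) part B:
# THE FINITE-ADELIC PRIMITIVE-SHELL SCHWARTZ–BRUHAT FUNCTION OF A FLAT DATUM — `Φ_f(a_f · e₂ k_f) = 𝟙_D(a) · β(k_S)`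

Cell `hodgecm-mathlib`, crux item hLiu418 = `stmt-HodgeConjecture-24832`; prover K2Liu-p14 (g0).  THEOREMS ONLY (no `def`, no instance, no notation,
no named-fact hypothesis, no `sorry`); lane `--supports stmt-HodgeConjecture-24832` (count-neutral helper).  GENERIC number field `K`, finite set `S` of
finite places, levels `γ_v` (`0 ≠ γ_v < 1`, `v ∈ S`).
THE DATUM (hypothesis-first, RULING M-157b (β4-i)): a function `β` of the `S`-TUPLE `(k_v)_{v∈S} : ∀ v : ↥S, GL₂(K_v)` — the finite part of a flat section
restricted to `GL₂(𝒪̂)`, spherical off `S` — LEFT-invariant under the upper-triangular integral tuples on integral tuples (`hB`) and RIGHT-invariant under the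
congruence tuples `∏_{v∈S} K_{γ_v}` (`hlev`); both invariances are stated for the PRODUCT group, so NO tensor decomposition of `β` over `S` is needed.
THE FUNCTION: `Φ_f(x) := β(κ_S(x)) · 𝟙[x ∈ 𝒪̂², x_v primitive for every v ∈ S]`, `κ_S(x)_v ∈ GL₂(𝒪_v)` any element with bottom row `x_v`
(★ (β1) `exists_glInt_apply_one_eq`; well defined by `hB`, ★ (β1) `mul_inv_apply_one_zero_eq_zero`).
MAIN **`exists_finiteAdelic_schwartzBruhat_of_flat`**: `Φ_f ∈ SchwartzBruhat((𝔸_K^∞)²)` (locally constant: on `x + {t : t_v ∈ 𝒪_v² (v ∉ S), |t_v| ≤ γ_v (v ∈ S)}`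
integrality and primitivity do not move — ★ part A — and the value does not move by the CONGRUENCE MOVE ★ part A `exists_congruenceGL_mul_apply_one_eq` + `hlev`;
compact support in `𝒪̂²`, ★ `isCompact_integralFiniteAdeles`) AND, for every idele `a` and every `k_f ∈ GL₂(𝒪̂)` (★ `glFiniteIntegralLevel`),
  `Φ_f(a_f · e₂ k_f) = 𝟙_D(a) · β((k_{f,v})_{v∈S})`,   `D = {|a_v|_v = 1 (v ∈ S), |a_v|_v ≤ 1 (v ∉ S)}` — VERBATIM the set of ★ (β4-ii) `K2LiuIdelicUnramifiedZetaProduct`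
(`a_v · e₂k_v` is primitive iff `|a_v| = 1`, integral iff `|a_v| ≤ 1` — ★ part A `prim_smul_iff`, `forall_valuation_smul_le_one_iff`; on `D` the bottom row
`a_v e₂ k_v = e₂(diag(1,a_v) k_v)` — ★ (β1) `smul_apply_one_eq_diagonalGL_mul` — is absorbed by `hB`).  This is the `hfin` face of (β4-iii).
HONEST LABEL.  `HC_CM` is proved only modulo the 7 printed citations (2 remaining named inputs: hLiu418 = `stmt-HodgeConjecture-24832`,
h413 = `stmt-HodgeConjecture-24833`) until rung 0 closes.

## References
* [JacquetLanglands1970] H. Jacquet, R. P. Langlands, *Automorphic forms on GL(2)*, LNM 114 (1970), §3 (the sections `f_Φ`), §11 p. 171.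
* [Bump1997] D. Bump, *Automorphic Forms and Representations* (1997), §3.7 (Godement sections), Prop. 4.5.2.
* [CogdellAnalyticTheory2004] J. W. Cogdell, *Analytic theory of L-functions for GL_n*, §2.3 (`F(g, Φ; s) = |det g|^s ∫ Φ(a e_n g)|a|^{ns} d^×a`).
* [CasselsFrohlichANT1967] J. W. S. Cassels, A. Fröhlich (eds.), *Algebraic Number Theory* (1967), Ch. II §14–§16 (restricted products, `𝒪̂`).
-/

set_option autoImplicit false
set_option linter.dupNamespace false -- the mandated namespace repeats `HodgeConjecture.HodgeConjecture`

noncomputable section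

open ValuativeRel NumberField IsDedekindDomain Set
open scoped MatrixGroups Matrix Classical
open Literature.NumberTheory
open Literature.NumberTheory.GaloisRepresentations
open Literature.NumberTheory.Automorphic
open Summit.HodgeConjecture.HodgeConjecture.Cruxes.HLiu418.K2LiuGL2GodementSectionOfFlatFinite
open Summit.HodgeConjecture.HodgeConjecture.Cruxes.HLiu418.K2LiuGL2PrimitiveRowNeighbourhoods

namespace Summit.HodgeConjecture.HodgeConjecture.Cruxes.HLiu418.K2LiuGL2GodementFiniteAdelicShell

variable {K : Type} [Field K] [NumberField K]

/-! ## §1 Coordinates: `K_v`-components of finite-adelic vectors, the two valuations of `K_v` -/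

/-- Mathlib's two valuations of `K_v` agree on "`≤ 1`" (both say `x ∈ 𝒪_v`). [folklore] -/
theorem valuation_le_one_iff_mem_adicCompletionIntegers (v : HeightOneSpectrum (𝓞 K)) (x : v.adicCompletion K) :
    valuation (v.adicCompletion K) x ≤ 1 ↔ x ∈ v.adicCompletionIntegers K := by
  rw [HeightOneSpectrum.mem_adicCompletionIntegers]
  exact (ValuativeRel.isEquiv (valuation (v.adicCompletion K)) (Valued.v : Valuation (v.adicCompletion K) _)).le_one_iff_le_one

/-- components of a difference of finite-adelic vectors. [folklore] -/
theorem sub_apply_apply (x y : Fin 2 → FiniteAdeleRing (𝓞 K) K) (j : Fin 2) (v : HeightOneSpectrum (𝓞 K)) :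
    (y - x) j v = y j v - x j v := rfl

/-- the `v`-component of `a_f · e₂ k_f` is `a_v · e₂ k_{f,v}` (`k_{f,v} = GLn.evalAt 2 K v k_f`). [folklore] -/
theorem mul_row_apply (a : ideleGroup K) (kf : GL (Fin 2) (FiniteAdeleRing (𝓞 K) K)) (v : HeightOneSpectrum (𝓞 K)) :
    (fun j => ((fun i => ((a : ideleGroup K) : AdeleRing (𝓞 K) K).2 * (kf : Matrix (Fin 2) (Fin 2) (FiniteAdeleRing (𝓞 K) K)) 1 i) j) v) =
      (((a : ideleGroup K) : AdeleRing (𝓞 K) K).2 v) • ((GLn.evalAt 2 K v kf : GL (Fin 2) (v.adicCompletion K)) :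
        Matrix (Fin 2) (Fin 2) (v.adicCompletion K)) 1 := by
  funext j
  rfl

/-! ## §2 The finite-adelic primitive-shell function -/

/-- **THE FINITE-ADELIC PRIMITIVE-SHELL SCHWARTZ–BRUHAT FUNCTION OF A FLAT DATUM** (RULING M-157b (β4-i); the `hfin` face of (β4-iii)).
For `β : (∀ v : ↥S, GL₂(K_v)) → ℂ` left-invariant under upper-triangular integral tuples on integral tuples (`hB`) and right-invariant under
`∏_{v∈S} K_{γ_v}` (`hlev`, `0 ≠ γ_v < 1`) there is `Φ_f ∈ SchwartzBruhat((𝔸_K^∞)²)` with, for every idele `a` and every `k_f ∈ GL₂(𝒪̂_K)`,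
`Φ_f(a_f · e₂ k_f) = 𝟙_D(a) · β((k_{f,v})_{v∈S})`, `D = {a : |a_v|_v = 1 (v ∈ S), |a_v|_v ≤ 1 (v ∉ S)}` (★ (β4-ii)'s set).
[cite: JacquetLanglands1970, §3] [cite: Bump1997, §3.7, Prop. 4.5.2] [cite: CogdellAnalyticTheory2004, §2.3] -/
theorem exists_finiteAdelic_schwartzBruhat_of_flat (S : Finset (HeightOneSpectrum (𝓞 K)))
    (γ : ∀ v : HeightOneSpectrum (𝓞 K), ValueGroupWithZero (v.adicCompletion K)) (hγ0 : ∀ v ∈ S, γ v ≠ 0) (hγ1 : ∀ v ∈ S, γ v < 1)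
    (β : (∀ v : ↥S, GL (Fin 2) (v.1.adicCompletion K)) → ℂ)
    (hB : ∀ p k : ∀ v : ↥S, GL (Fin 2) (v.1.adicCompletion K),
      (∀ v, p v ∈ glInt 2 (v.1.adicCompletion K)) →
      (∀ v, ((p v : GL (Fin 2) (v.1.adicCompletion K)) : Matrix (Fin 2) (Fin 2) (v.1.adicCompletion K)) 1 0 = 0) →
      (∀ v, k v ∈ glInt 2 (v.1.adicCompletion K)) → β (p * k) = β k)
    (hlev : ∀ k u : ∀ v : ↥S, GL (Fin 2) (v.1.adicCompletion K),
      (∀ v, k v ∈ glInt 2 (v.1.adicCompletion K)) → (∀ v, u v ∈ congruenceGL 2 (γ v.1)) → β (k * u) = β k) :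
    ∃ Φf : (Fin 2 → FiniteAdeleRing (𝓞 K) K) → ℂ, Φf ∈ SchwartzBruhat (Fin 2 → FiniteAdeleRing (𝓞 K) K) ∧
      ∀ (a : ideleGroup K) (kf : GL (Fin 2) (FiniteAdeleRing (𝓞 K) K)), kf ∈ glFiniteIntegralLevel 2 K →
        Φf (fun i => ((a : ideleGroup K) : AdeleRing (𝓞 K) K).2 * (kf : Matrix (Fin 2) (Fin 2) (FiniteAdeleRing (𝓞 K) K)) 1 i) =
          {a : ideleGroup K | (∀ v ∈ S, Valued.v (((a : ideleGroup K) : AdeleRing (𝓞 K) K).2 v) = 1) ∧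
              ∀ v, v ∉ S → Valued.v (((a : ideleGroup K) : AdeleRing (𝓞 K) K).2 v) ≤ 1}.indicator (fun _ => (1 : ℂ)) a *
            β (fun v : ↥S => GLn.evalAt 2 K v.1 kf) := by
  -- the shell condition `C x`: `x ∈ 𝒪̂²` and `x_v` primitive for `v ∈ S`
  set C : (Fin 2 → FiniteAdeleRing (𝓞 K) K) → Prop := fun x =>
    (∀ (v : HeightOneSpectrum (𝓞 K)) (j : Fin 2), valuation (v.adicCompletion K) (x j v) ≤ 1) ∧
      ∀ v ∈ S, (∀ j, valuation (v.adicCompletion K) (x j v) ≤ 1) ∧ ∃ j, valuation (v.adicCompletion K) (x j v) = 1 with hC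
  -- the choice `κ_S(x)`
  have hκex : ∀ {x : Fin 2 → FiniteAdeleRing (𝓞 K) K} (_ : C x) (v : ↥S),
      ∃ k ∈ glInt 2 (v.1.adicCompletion K), (k : Matrix (Fin 2) (Fin 2) (v.1.adicCompletion K)) 1 = fun j => x j v.1 :=
    fun h v => exists_glInt_apply_one_eq (h.2 v.1 v.2)
  let κ : ∀ {x : Fin 2 → FiniteAdeleRing (𝓞 K) K}, C x → ∀ v : ↥S, GL (Fin 2) (v.1.adicCompletion K) :=
    fun h v => Classical.choose (hκex h v)
  have hκK : ∀ {x : Fin 2 → FiniteAdeleRing (𝓞 K) K} (h : C x) (v : ↥S), κ h v ∈ glInt 2 (v.1.adicCompletion K) :=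
    fun h v => (Classical.choose_spec (hκex h v)).1
  have hκrow : ∀ {x : Fin 2 → FiniteAdeleRing (𝓞 K) K} (h : C x) (v : ↥S),
      (κ h v : Matrix (Fin 2) (Fin 2) (v.1.adicCompletion K)) 1 = fun j => x j v.1 :=
    fun h v => (Classical.choose_spec (hκex h v)).2
  -- the function
  let Φf : (Fin 2 → FiniteAdeleRing (𝓞 K) K) → ℂ := fun x => if h : C x then β (κ h) else 0
  have h0 : ∀ {x : Fin 2 → FiniteAdeleRing (𝓞 K) K}, ¬ C x → Φf x = 0 := fun h => by simp only [Φf, dif_neg h]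
  -- KEY: on the shell the value is `β k` for ANY integral tuple `k` with the right bottom rows (`hB`)
  have hval : ∀ {x : Fin 2 → FiniteAdeleRing (𝓞 K) K} (h : C x) (k : ∀ v : ↥S, GL (Fin 2) (v.1.adicCompletion K)),
      (∀ v, k v ∈ glInt 2 (v.1.adicCompletion K)) →
      (∀ v, (k v : Matrix (Fin 2) (Fin 2) (v.1.adicCompletion K)) 1 = fun j => x j v.1) → Φf x = β k := by
    intro x h k hk hkrow
    simp only [Φf, dif_pos h]
    have hp := hB (κ h * k⁻¹) k (fun v => Subgroup.mul_mem _ (hκK h v) (Subgroup.inv_mem _ (hk v)))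
      (fun v => mul_inv_apply_one_zero_eq_zero ((hκrow h v).trans (hkrow v).symm)) hk
    rwa [inv_mul_cancel_right] at hp
  refine ⟨Φf, ?_, fun a kf hkf => ?_⟩
  · -- `Φf ∈ SchwartzBruhat`
    rw [mem_schwartzBruhat_iff]
    constructor
    · -- locally constant
      rw [IsLocallyConstant.iff_exists_open]
      intro x
      -- the neighbourhood `x + T²`, `T = {t : t_v ∈ 𝒪_v (v ∉ S), |t_v| ≤ γ_v (v ∈ S)}`
      set T : Set (FiniteAdeleRing (𝓞 K) K) := {f | (∀ v, v ∉ S → f v ∈ v.adicCompletionIntegers K) ∧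
        ∀ v ∈ S, valuation (v.adicCompletion K) (f v) ≤ γ v} with hT
      have hTo : IsOpen T := by
        have h1 : IsOpen {f : FiniteAdeleRing (𝓞 K) K | ∀ v, v ∉ S → f v ∈ v.adicCompletionIntegers K} :=
          RestrictedProduct.isOpen_forall_imp_mem fun w => Valued.isOpen_valuationSubring _
        have h2 : IsOpen (⋂ v ∈ S, (AdelicGroupData.finiteAdeleEval K v) ⁻¹'
            {z : v.adicCompletion K | valuation (v.adicCompletion K) z ≤ γ v}) :=
          isOpen_biInter_finset fun v hv =>
            (DeltaCharBorel.isOpen_setOf_valuation_le (hγ0 v hv)).preimage (AdelicGroupData.continuous_finiteAdeleEval K v)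
        have heq : T = {f : FiniteAdeleRing (𝓞 K) K | ∀ v, v ∉ S → f v ∈ v.adicCompletionIntegers K} ∩
            ⋂ v ∈ S, (AdelicGroupData.finiteAdeleEval K v) ⁻¹' {z : v.adicCompletion K | valuation (v.adicCompletion K) z ≤ γ v} := by
          ext f
          simp only [hT, Set.mem_setOf_eq, Set.mem_inter_iff, Set.mem_iInter, Set.mem_preimage, AdelicGroupData.finiteAdeleEval_apply]
        rw [heq]
        exact h1.inter h2
      refine ⟨{y | ∀ i, (y - x) i ∈ T}, ?_, fun i => ?_, fun y hy => ?_⟩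
      · have : {y : Fin 2 → FiniteAdeleRing (𝓞 K) K | ∀ i, (y - x) i ∈ T} = ⋂ i, (fun y => y i - x i) ⁻¹' T := by
          ext y; simp
        rw [this]
        exact isOpen_iInter_of_finite fun i => hTo.preimage ((continuous_apply i).sub continuous_const)
      · simp only [hT, sub_self, Pi.zero_apply, Set.mem_setOf_eq]
        exact ⟨fun v _ => zero_mem _, fun v _ => by rw [show ((0 : FiniteAdeleRing (𝓞 K) K) v) = 0 from rfl, map_zero]; exact bot_le⟩
      · -- the differences, place by place
        have hdS : ∀ v ∈ S, ∀ j, valuation (v.adicCompletion K) (((fun j => y j v) - fun j => x j v) j) ≤ γ v := by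
          intro v hv j
          rw [Pi.sub_apply, ← sub_apply_apply]
          exact (hy j).2 v hv
        have hd1 : ∀ (v : HeightOneSpectrum (𝓞 K)) (j : Fin 2), valuation (v.adicCompletion K) (((fun j => y j v) - fun j => x j v) j) ≤ 1 := by
          intro v j
          by_cases hv : v ∈ S
          · exact (hdS v hv j).trans (hγ1 v hv).le
          · rw [Pi.sub_apply, ← sub_apply_apply]
            exact (valuation_le_one_iff_mem_adicCompletionIntegers v _).2 ((hy j).1 v hv)
        have hlt : ∀ v ∈ S, ∀ j, valuation (v.adicCompletion K) (((fun j => y j v) - fun j => x j v) j) < 1 :=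
          fun v hv j => lt_of_le_of_lt (hdS v hv j) (hγ1 v hv)
        -- the shell condition does not move
        have hCiff : C y ↔ C x :=
          and_congr (forall_congr' fun v => forall_valuation_le_one_iff_of_sub (hd1 v))
            (forall_congr' fun v => forall_congr' fun hv =>
              ⟨fun h => by_contra fun hx => not_prim_of_forall_valuation_sub_lt_one hx (hlt v hv) h,
                fun h => prim_of_forall_valuation_sub_lt_one h (hlt v hv)⟩)
        by_cases hx : C x
        · have hyC : C y := hCiff.2 hx
          -- the congruence move at each `v ∈ S`
          have hu : ∀ v : ↥S, ∃ u ∈ congruenceGL 2 (γ v.1),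
              ((κ hx v * u : GL (Fin 2) (v.1.adicCompletion K)) : Matrix (Fin 2) (Fin 2) (v.1.adicCompletion K)) 1 = fun j => y j v.1 := by
            intro v
            refine exists_congruenceGL_mul_apply_one_eq (hγ1 v.1 v.2) (hκK hx v) fun j => ?_
            rw [hκrow hx v]
            exact hdS v.1 v.2 j
          choose u huγ hurow using hu
          rw [hval hyC (fun v => κ hx v * u v) (fun v => Subgroup.mul_mem _ (hκK hx v) (congruenceGL_le_glInt _ (huγ v))) hurow,
            hval hx (κ hx) (hκK hx) (hκrow hx)]
          exact hlev (κ hx) u (hκK hx) huγ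
        · rw [h0 hx, h0 fun h => hx (hCiff.1 h)]
    · -- compact support inside `𝒪̂²`
      refine HasCompactSupport.intro (K := Set.pi Set.univ fun _ : Fin 2 => (integralFiniteAdeles K : Set (FiniteAdeleRing (𝓞 K) K)))
        (isCompact_univ_pi fun _ => isCompact_integralFiniteAdeles K) fun x hx => h0 fun hCx => hx ?_
      exact fun j _ => mem_integralFiniteAdeles_iff.2 fun v => (valuation_le_one_iff_mem_adicCompletionIntegers v _).1 (hCx.1 v j)
  · -- the value at `x = a_f · e₂ k_f`
    have hkv : ∀ v : HeightOneSpectrum (𝓞 K), GLn.evalAt 2 K v kf ∈ glInt 2 (v.adicCompletion K) :=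
      (GLn.mem_glFiniteIntegralLevel_iff_forall_evalAt 2 K kf).1 hkf
    have hrow : ∀ v : HeightOneSpectrum (𝓞 K),
        (∀ j, valuation (v.adicCompletion K) (((GLn.evalAt 2 K v kf : GL (Fin 2) (v.adicCompletion K)) :
          Matrix (Fin 2) (Fin 2) (v.adicCompletion K)) 1 j) ≤ 1) ∧
        ∃ j, valuation (v.adicCompletion K) (((GLn.evalAt 2 K v kf : GL (Fin 2) (v.adicCompletion K)) :
          Matrix (Fin 2) (Fin 2) (v.adicCompletion K)) 1 j) = 1 :=
      fun v => prim_apply_of_mem_glInt (hkv v) 1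
    set x : Fin 2 → FiniteAdeleRing (𝓞 K) K :=
      fun i => ((a : ideleGroup K) : AdeleRing (𝓞 K) K).2 * (kf : Matrix (Fin 2) (Fin 2) (FiniteAdeleRing (𝓞 K) K)) 1 i with hxdef
    have hxv : ∀ v : HeightOneSpectrum (𝓞 K), (fun j => x j v) =
        (((a : ideleGroup K) : AdeleRing (𝓞 K) K).2 v) • ((GLn.evalAt 2 K v kf : GL (Fin 2) (v.adicCompletion K)) :
          Matrix (Fin 2) (Fin 2) (v.adicCompletion K)) 1 :=
      fun v => mul_row_apply a kf v
    by_cases hD : a ∈ {a : ideleGroup K | (∀ v ∈ S, Valued.v (((a : ideleGroup K) : AdeleRing (𝓞 K) K).2 v) = 1) ∧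
        ∀ v, v ∉ S → Valued.v (((a : ideleGroup K) : AdeleRing (𝓞 K) K).2 v) ≤ 1}
    · rw [Set.indicator_of_mem hD, one_mul]
      obtain ⟨hDS, hDnS⟩ := hD
      have hav1 : ∀ v ∈ S, valuation (v.adicCompletion K) ((((a : ideleGroup K) : AdeleRing (𝓞 K) K).2 v)) = 1 :=
        fun v hv => (valued_eq_one_iff_valuation_eq_one v _).1 (hDS v hv)
      have havle : ∀ v : HeightOneSpectrum (𝓞 K), valuation (v.adicCompletion K) ((((a : ideleGroup K) : AdeleRing (𝓞 K) K).2 v)) ≤ 1 := by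
        intro v
        by_cases hv : v ∈ S
        · exact (hav1 v hv).le
        · exact (valuation_le_one_iff_mem_adicCompletionIntegers v _).2
            ((HeightOneSpectrum.mem_adicCompletionIntegers _ _ _).2 (hDnS v hv))
      -- `x` lies on the shell
      have hCx : C x := by
        refine ⟨fun v => ?_, fun v hv => ?_⟩
        · have h := (forall_valuation_smul_le_one_iff (hrow v) ((((a : ideleGroup K) : AdeleRing (𝓞 K) K).2 v))).2 (havle v)
          rw [← hxv v] at h
          exact h
        · have h := (prim_smul_iff (hrow v) ((((a : ideleGroup K) : AdeleRing (𝓞 K) K).2 v))).2 (hav1 v hv)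
          rw [← hxv v] at h
          exact h
      -- the tuple `(diag(1, a_v) k_{f,v})_{v ∈ S}` has bottom rows `x_v`
      have ha0 : ∀ v : ↥S, (((a : ideleGroup K) : AdeleRing (𝓞 K) K).2 v.1) ≠ 0 := by
        intro v h0'
        have h1 := hav1 v.1 v.2
        rw [h0', map_zero] at h1
        exact zero_ne_one h1
      have hdiag : ∀ v : ↥S, diagonalGL (Fin 2) (v.1.adicCompletion K) ![1, Units.mk0 _ (ha0 v)] ∈ glInt 2 (v.1.adicCompletion K) :=
        fun v => diagonalGL_one_mem_glInt (hav1 v.1 v.2)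
      rw [hval hCx (fun v : ↥S => diagonalGL (Fin 2) (v.1.adicCompletion K) ![1, Units.mk0 _ (ha0 v)] * GLn.evalAt 2 K v.1 kf)
        (fun v => Subgroup.mul_mem _ (hdiag v) (hkv v.1)) (fun v => ?_)]
      · exact hB (fun v : ↥S => diagonalGL (Fin 2) (v.1.adicCompletion K) ![1, Units.mk0 _ (ha0 v)]) (fun v : ↥S => GLn.evalAt 2 K v.1 kf)
          hdiag (fun v => diagonalGL_one_apply_one_zero _) (fun v => hkv v.1)
      · rw [hxv v.1]
        exact (smul_apply_one_eq_diagonalGL_mul (Units.mk0 _ (ha0 v)) (GLn.evalAt 2 K v.1 kf)).symm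
    · rw [Set.indicator_of_notMem hD, zero_mul]
      refine h0 fun hCx => hD ⟨fun v hv => ?_, fun v hv => ?_⟩
      · have h : (∀ j, valuation (v.adicCompletion K) ((fun j => x j v) j) ≤ 1) ∧
            ∃ j, valuation (v.adicCompletion K) ((fun j => x j v) j) = 1 := hCx.2 v hv
        rw [hxv v] at h
        exact (valued_eq_one_iff_valuation_eq_one v _).2 ((prim_smul_iff (hrow v) _).1 h)
      · have h : ∀ j, valuation (v.adicCompletion K) ((fun j => x j v) j) ≤ 1 := hCx.1 v
        rw [hxv v] at h
        exact (HeightOneSpectrum.mem_adicCompletionIntegers _ _ _).1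
          ((valuation_le_one_iff_mem_adicCompletionIntegers v _).1 ((forall_valuation_smul_le_one_iff (hrow v) _).1 h))

end Summit.HodgeConjecture.HodgeConjecture.Cruxes.HLiu418.K2LiuGL2GodementFiniteAdelicShell

end
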